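import Summits.Ventures.CertifiedQuantumChemistry.Rows.HeisenbergRingL14KernelData
import Summits.Ventures.CertifiedQuantumChemistry.Rows.HeisenbergSectorCollatzWielandt
import HarnessLib

/-!
# Ventures/CertifiedQuantumChemistry — Rows/HeisenbergRingL14GroundEnergyBracket.lean: a KERNEL two-sided bracket of the
# ground-state energy of the spin-½ antiferromagnetic Heisenberg ring of 14 sites by a Collatz–Wielandt certificate,
# `E₀ ∈ [A, B]/(4·10¹⁹)`, `h(14) = 7/2 − E₀ ∈ [9.763549533547036, 9.763549533547038]` (T-H14(α-bracket), part 2 of 2)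

HONEST FRAMING (verbatim): certified bounds for a stated model Hamiltonian in a stated basis; not a
claim about the real molecule beyond that model.

Seat ref/typer (`pub-qchem-typer`, gen 22). The kernel form of the `L = 14` row of the stdlib deposit
`HOME/pub-qchem-typer/h-cw-cert/` (`cw_L14.json`: `h(14) ∈ [9.7635495335470, 9.7635495335471]` at grade (β), the h-input that
HOME/STRUCTURE.md §2.5.7 «ENC-14 FORM» (F1) names; this file is the optional 'T-H14 leg' of (F5)(viii) and nothing else:
no rider, no emission, no solve, no threshold, nothing registered or scored): the SAME Collatz–Wielandt argument as
`Rows/HeisenbergRingL12GroundEnergyBracket.lean` (T-H12(α)), checked by the Lean kernel through the soundness theorem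
`groundEnergy_mem_Icc_of_marshall_positive_trial` of `Rows/HeisenbergSectorCollatzWielandt.lean`. THEOREMS here; the explicit
finite data they are about and the sixteen kernel evaluations are part 1, `Rows/HeisenbergRingL14KernelData.lean`
(`def`s: the orbit-class table in sixteen chunks, the 85 integer orbit values of the trial vector, two integer bound
numerators, the bookkeeping functions; `check_chunk0 … check_chunk15`); no claim node, no row, no certificate file; zero compute
(kernel evaluation, `decide +kernel`, sixteen chunks of 1024 masks), standard axioms; NOT a row, scores nothing. A BRACKET
only (no exact algebraic value is attempted at `L = 14`). Compared with T-H12(α) the mask ↔ configuration bridge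
(`cfg_enc`, `enc_lt`), the Marshall exponent and `msZ² = 1` are proved STRUCTURALLY here (binary digits by `omega`,
`linarith`, finite-set rewriting) instead of by kernel enumeration of the `2¹⁴` configurations.

## Statement (`groundEnergy_mem_Icc`, `h14_mem_Icc`)

  `E₀(heisenbergHamiltonian 1 (ringGraph 14) 1) ∈ [A/(4·10¹⁹), B/(4·10¹⁹)]`,
  `A = -250541981341881481111`, `B = -250541981341881476371`
  (`⊆ [-6.263549533547038, -6.263549533547036]`, width `1.2e-16`), hence
  `h(14) := 7/2 − E₀ ∈ [9.763549533547036, 9.763549533547038]` (`μ₁₄ = 4h(14) = 39.0541981341881…`; inside the (β) bracket of `cw_L14.json`).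

## Certificate and proof

`w(σ) := (−1)^{σ_0+σ_2+⋯+σ_12} · u_{cls σ}` on the `3432` weight-`7` configurations (zero elsewhere), with the `85`
positive integers `u_k` (`uval`; a Perron vector of the orbit block, obtained by INTEGER power iteration and rounded to
`10⁻²²` relative) on the orbit classes of `D₁₄ ×` spin flip (`clsTab0 … clsTab15`, 7 bits per bit-mask). With
`T'(σ) := (−1)^{Σ_even σ}·4(Hw)(σ) ∈ ℤ` (`tnum`; `4(Hw)(σ) = Σ_bonds (w(σ) | −w(σ) + 2w(σ∘swap))` by part 1's
`heisenbergHamiltonian_one_mulVec_apply`), the local energies are `q_σ = (Hw)(σ)/w(σ) = T'(σ)/(4u_{cls σ})`, and the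
kernel checks the `2 × 3432` INTEGER inequalities `A·u_{cls σ} ≤ 10¹⁹·T'(σ) ≤ B·u_{cls σ}` over the `16384` bit-masks
(`check_chunk0 … check_chunk15`, `decide +kernel`; `cfg_enc` transports masks ↔ `Fin 14 → Fin 2`), i.e.
`q_σ ∈ [A, B]/(4·10¹⁹)`; `w` is strictly Marshall-positive (`marshallSign (evenSites 14) σ · w(σ) = u_{cls σ} > 0`), the
14-ring is connected and bipartite in its even sites with `2·7 = 14`, so `groundEnergy_mem_Icc_of_marshall_positive_trial`
gives the bracket. Independent stdlib numerics (exact integers, no floats): `HOME/pub-qchem-typer/staged/g22/ring14_cw_data.py`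
(re-derives the classes, `u`, `T'`, `A`, `B` and all inequalities; `T'/u` is class-constant); consistent with the (β)
deposit `h-cw-cert/cw_L14.json` (`μ₁₄ ∈ [39.0541981341881, 39.0541981341882]`), whose bracket CONTAINS this file's.

References: Marshall (1955) [Marshall1955]; Lieb–Mattis (1962) Thm 2 [LiebMattis1962]; Tasaki (2020) §2.4, Thm 2.3 [Tasaki2020];
Horn–Johnson (2013) Cor. 8.1.29 (Collatz–Wielandt) [HornJohnson2013]; finite even rings `E₀(N)/N`, `N ≤ 10`, and the
extrapolation to Hulthén's `1/4 − ln 2` (Bonner–Fisher 1964) [BonnerFisher1964]. Typer `pub-qchem-typer` (gen 22), 0 core-h.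
-/

noncomputable section

namespace Summit.Ventures.CertifiedQuantumChemistry

open Matrix Finset
open Literature.MathematicalPhysics.QuantumLattice

namespace HeisenbergRing14

/-! ### The mask ↔ configuration bridge (structural) -/

/-- Binary digit `0` of the mask. -/
private theorem dg0 (σ : Fin 14 → Fin 2) : (if enc σ / 2 ^ 0 % 2 = 1 then 1 else 0) = (σ 0).val := by
  have h0 := (σ 0).isLt
  unfold enc
  split <;> omega

/-- Binary digit `1` of the mask. -/
private theorem dg1 (σ : Fin 14 → Fin 2) : (if enc σ / 2 ^ 1 % 2 = 1 then 1 else 0) = (σ 1).val := by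
  have h0 := (σ 0).isLt; have h1 := (σ 1).isLt
  unfold enc
  split <;> omega

/-- Binary digit `2` of the mask. -/
private theorem dg2 (σ : Fin 14 → Fin 2) : (if enc σ / 2 ^ 2 % 2 = 1 then 1 else 0) = (σ 2).val := by
  have h0 := (σ 0).isLt; have h1 := (σ 1).isLt; have h2 := (σ 2).isLt
  unfold enc
  split <;> omega

/-- Binary digit `3` of the mask. -/
private theorem dg3 (σ : Fin 14 → Fin 2) : (if enc σ / 2 ^ 3 % 2 = 1 then 1 else 0) = (σ 3).val := by
  have h0 := (σ 0).isLt; have h1 := (σ 1).isLt; have h2 := (σ 2).isLt; have h3 := (σ 3).isLt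
  unfold enc
  split <;> omega

/-- Binary digit `4` of the mask. -/
private theorem dg4 (σ : Fin 14 → Fin 2) : (if enc σ / 2 ^ 4 % 2 = 1 then 1 else 0) = (σ 4).val := by
  have h0 := (σ 0).isLt; have h1 := (σ 1).isLt; have h2 := (σ 2).isLt; have h3 := (σ 3).isLt
  have h4 := (σ 4).isLt
  unfold enc
  split <;> omega

/-- Binary digit `5` of the mask. -/
private theorem dg5 (σ : Fin 14 → Fin 2) : (if enc σ / 2 ^ 5 % 2 = 1 then 1 else 0) = (σ 5).val := by
  have h0 := (σ 0).isLt; have h1 := (σ 1).isLt; have h2 := (σ 2).isLt; have h3 := (σ 3).isLt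
  have h4 := (σ 4).isLt; have h5 := (σ 5).isLt
  unfold enc
  split <;> omega

/-- Binary digit `6` of the mask. -/
private theorem dg6 (σ : Fin 14 → Fin 2) : (if enc σ / 2 ^ 6 % 2 = 1 then 1 else 0) = (σ 6).val := by
  have h0 := (σ 0).isLt; have h1 := (σ 1).isLt; have h2 := (σ 2).isLt; have h3 := (σ 3).isLt
  have h4 := (σ 4).isLt; have h5 := (σ 5).isLt; have h6 := (σ 6).isLt
  unfold enc
  split <;> omega

/-- Binary digit `7` of the mask. -/
private theorem dg7 (σ : Fin 14 → Fin 2) : (if enc σ / 2 ^ 7 % 2 = 1 then 1 else 0) = (σ 7).val := by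
  have h0 := (σ 0).isLt; have h1 := (σ 1).isLt; have h2 := (σ 2).isLt; have h3 := (σ 3).isLt
  have h4 := (σ 4).isLt; have h5 := (σ 5).isLt; have h6 := (σ 6).isLt; have h7 := (σ 7).isLt
  unfold enc
  split <;> omega

/-- Binary digit `8` of the mask. -/
private theorem dg8 (σ : Fin 14 → Fin 2) : (if enc σ / 2 ^ 8 % 2 = 1 then 1 else 0) = (σ 8).val := by
  have h0 := (σ 0).isLt; have h1 := (σ 1).isLt; have h2 := (σ 2).isLt; have h3 := (σ 3).isLt
  have h4 := (σ 4).isLt; have h5 := (σ 5).isLt; have h6 := (σ 6).isLt; have h7 := (σ 7).isLt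
  have h8 := (σ 8).isLt
  unfold enc
  split <;> omega

/-- Binary digit `9` of the mask. -/
private theorem dg9 (σ : Fin 14 → Fin 2) : (if enc σ / 2 ^ 9 % 2 = 1 then 1 else 0) = (σ 9).val := by
  have h0 := (σ 0).isLt; have h1 := (σ 1).isLt; have h2 := (σ 2).isLt; have h3 := (σ 3).isLt
  have h4 := (σ 4).isLt; have h5 := (σ 5).isLt; have h6 := (σ 6).isLt; have h7 := (σ 7).isLt
  have h8 := (σ 8).isLt; have h9 := (σ 9).isLt
  unfold enc
  split <;> omega

/-- Binary digit `10` of the mask. -/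
private theorem dg10 (σ : Fin 14 → Fin 2) : (if enc σ / 2 ^ 10 % 2 = 1 then 1 else 0) = (σ 10).val := by
  have h0 := (σ 0).isLt; have h1 := (σ 1).isLt; have h2 := (σ 2).isLt; have h3 := (σ 3).isLt
  have h4 := (σ 4).isLt; have h5 := (σ 5).isLt; have h6 := (σ 6).isLt; have h7 := (σ 7).isLt
  have h8 := (σ 8).isLt; have h9 := (σ 9).isLt; have h10 := (σ 10).isLt
  unfold enc
  split <;> omega

/-- Binary digit `11` of the mask. -/
private theorem dg11 (σ : Fin 14 → Fin 2) : (if enc σ / 2 ^ 11 % 2 = 1 then 1 else 0) = (σ 11).val := by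
  have h0 := (σ 0).isLt; have h1 := (σ 1).isLt; have h2 := (σ 2).isLt; have h3 := (σ 3).isLt
  have h4 := (σ 4).isLt; have h5 := (σ 5).isLt; have h6 := (σ 6).isLt; have h7 := (σ 7).isLt
  have h8 := (σ 8).isLt; have h9 := (σ 9).isLt; have h10 := (σ 10).isLt; have h11 := (σ 11).isLt
  unfold enc
  split <;> omega

/-- Binary digit `12` of the mask. -/
private theorem dg12 (σ : Fin 14 → Fin 2) : (if enc σ / 2 ^ 12 % 2 = 1 then 1 else 0) = (σ 12).val := by
  have h0 := (σ 0).isLt; have h1 := (σ 1).isLt; have h2 := (σ 2).isLt; have h3 := (σ 3).isLt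
  have h4 := (σ 4).isLt; have h5 := (σ 5).isLt; have h6 := (σ 6).isLt; have h7 := (σ 7).isLt
  have h8 := (σ 8).isLt; have h9 := (σ 9).isLt; have h10 := (σ 10).isLt; have h11 := (σ 11).isLt
  have h12 := (σ 12).isLt
  unfold enc
  split <;> omega

/-- Binary digit `13` of the mask. -/
private theorem dg13 (σ : Fin 14 → Fin 2) : (if enc σ / 2 ^ 13 % 2 = 1 then 1 else 0) = (σ 13).val := by
  have h0 := (σ 0).isLt; have h1 := (σ 1).isLt; have h2 := (σ 2).isLt; have h3 := (σ 3).isLt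
  have h4 := (σ 4).isLt; have h5 := (σ 5).isLt; have h6 := (σ 6).isLt; have h7 := (σ 7).isLt
  have h8 := (σ 8).isLt; have h9 := (σ 9).isLt; have h10 := (σ 10).isLt; have h11 := (σ 11).isLt
  have h12 := (σ 12).isLt; have h13 := (σ 13).isLt
  unfold enc
  split <;> omega

/-- Every configuration is the configuration of its mask (binary digits). -/
theorem cfg_enc (σ : Fin 14 → Fin 2) : cfg (enc σ) = σ := by
  funext ⟨k, hk⟩
  rw [Fin.ext_iff]
  simp only [cfg, Nat.testBit_eq_decide_div_mod_eq, decide_eq_true_eq, apply_ite Fin.val, Fin.val_one,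
    Fin.val_zero]
  match k, hk with
  | 0, _ => exact dg0 σ
  | 1, _ => exact dg1 σ
  | 2, _ => exact dg2 σ
  | 3, _ => exact dg3 σ
  | 4, _ => exact dg4 σ
  | 5, _ => exact dg5 σ
  | 6, _ => exact dg6 σ
  | 7, _ => exact dg7 σ
  | 8, _ => exact dg8 σ
  | 9, _ => exact dg9 σ
  | 10, _ => exact dg10 σ
  | 11, _ => exact dg11 σ
  | 12, _ => exact dg12 σ
  | 13, _ => exact dg13 σ
  | _ + 14, h => exact absurd h (by omega)

/-- Masks are `< 16384`. -/
theorem enc_lt (σ : Fin 14 → Fin 2) : enc σ < 16384 := by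
  have h0 := (σ 0).isLt; have h1 := (σ 1).isLt; have h2 := (σ 2).isLt; have h3 := (σ 3).isLt
  have h4 := (σ 4).isLt; have h5 := (σ 5).isLt; have h6 := (σ 6).isLt; have h7 := (σ 7).isLt
  have h8 := (σ 8).isLt; have h9 := (σ 9).isLt; have h10 := (σ 10).isLt; have h11 := (σ 11).isLt
  have h12 := (σ 12).isLt; have h13 := (σ 13).isLt
  unfold enc
  linarith


/-! ## §2 Assembly: local energies, Marshall positivity, and the bracket -/

open Summit.Ventures.CertifiedQuantumChemistry.Hamiltonians

/-- The integer inequalities hold at every weight-`7` configuration (from the sixteen kernel chunks). -/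
theorem check_of_wt (σ : Fin 14 → Fin 2) (hσ : wt σ = 7) :
    boundA * uval (cls (enc σ)) ≤ 10 ^ 19 * tnum σ ∧ 10 ^ 19 * tnum σ ≤ boundB * uval (cls (enc σ)) := by
  have hlt := enc_lt σ
  have key : checkMask (enc σ) = true := by
    have he : enc σ = enc σ % 1024 + 1024 * (enc σ / 1024) := (Nat.mod_add_div _ _).symm
    have hr : enc σ % 1024 < 1024 := Nat.mod_lt _ (by norm_num)
    have hc : enc σ / 1024 < 16 := by omega
    interval_cases h : enc σ / 1024
    · rw [he]; simpa using check_chunk0 ⟨_, hr⟩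
    · rw [he]; exact check_chunk1 ⟨_, hr⟩
    · rw [he]; exact check_chunk2 ⟨_, hr⟩
    · rw [he]; exact check_chunk3 ⟨_, hr⟩
    · rw [he]; exact check_chunk4 ⟨_, hr⟩
    · rw [he]; exact check_chunk5 ⟨_, hr⟩
    · rw [he]; exact check_chunk6 ⟨_, hr⟩
    · rw [he]; exact check_chunk7 ⟨_, hr⟩
    · rw [he]; exact check_chunk8 ⟨_, hr⟩
    · rw [he]; exact check_chunk9 ⟨_, hr⟩
    · rw [he]; exact check_chunk10 ⟨_, hr⟩
    · rw [he]; exact check_chunk11 ⟨_, hr⟩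
    · rw [he]; exact check_chunk12 ⟨_, hr⟩
    · rw [he]; exact check_chunk13 ⟨_, hr⟩
    · rw [he]; exact check_chunk14 ⟨_, hr⟩
    · rw [he]; exact check_chunk15 ⟨_, hr⟩
  rw [checkMask, cfg_enc] at key
  simpa [hσ] using key

/-- The trial vector `w` as a complex vector on all configurations (zero off the weight-`7` sector). -/
def vec (σ : Fin 14 → Fin 2) : ℂ := if wt σ = 7 then ((wInt σ : ℤ) : ℂ) else 0

/-- The written-out weight is the weight `Σ_z σ_z`. -/
theorem wt_eq_sum (σ : Fin 14 → Fin 2) : wt σ = ∑ z, (σ z : ℕ) := by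
  simp only [wt, Fin.sum_univ_succ, Fin.sum_univ_zero, add_zero, ← add_assoc]
  rfl

/-- Exchanging two spins preserves the weight (a permutation of the summands). -/
theorem wt_comp_swap (σ : Fin 14 → Fin 2) (i : Fin 14) : wt (σ ∘ Equiv.swap i (i + 1)) = wt σ := by
  rw [wt_eq_sum, wt_eq_sum]
  exact Equiv.sum_comp (Equiv.swap i (i + 1)) (fun z => ((σ z : Fin 2) : ℕ))

/-- The Marshall exponent: `Σ_{x ∈ evenSites 14} σ_x = σ_0 + σ_2 + ⋯ + σ_12` (the even sites are `{0, 2, …, 12}`). -/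
theorem sum_evenSites_eq (σ : Fin 14 → Fin 2) : (∑ x ∈ evenSites 14, (σ x : ℕ)) =
    (σ 0).val + (σ 2).val + (σ 4).val + (σ 6).val + (σ 8).val + (σ 10).val + (σ 12).val := by
  have hset : evenSites 14 = {0, 2, 4, 6, 8, 10, 12} := by decide
  rw [hset, Finset.sum_insert (by decide), Finset.sum_insert (by decide), Finset.sum_insert (by decide),
    Finset.sum_insert (by decide), Finset.sum_insert (by decide), Finset.sum_insert (by decide),
    Finset.sum_singleton]
  ring

/-- The integer Marshall sign squares to one. -/
theorem msZ_mul_msZ (σ : Fin 14 → Fin 2) : msZ σ * msZ σ = 1 := by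
  rw [msZ, ← pow_add, ← two_mul, pow_mul]
  norm_num

/-- The tree's Marshall sign of the even sublattice is the integer `msZ`. -/
theorem marshallSign_evenSites_eq (σ : Fin 14 → Fin 2) : marshallSign (evenSites 14) σ = (msZ σ : ℂ) := by
  rw [marshallSign, sum_evenSites_eq, msZ]
  push_cast
  rfl

/-- The orbit values are positive. -/
theorem uval_pos (k : ℕ) : 0 < uval k := by
  unfold uval
  split <;> decide

/-- Four times one bond term of `H w` at a weight-`7` configuration is the integer `bondT`. -/
theorem four_mul_bondTerm (σ : Fin 14 → Fin 2) (hσ : wt σ = 7) (i : Fin 14) :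
    (4 : ℂ) * heisenbergBondTerm vec σ i (i + 1) = (bondT σ i : ℂ) := by
  have hσ' : wt (σ ∘ Equiv.swap i (i + 1)) = 7 := by rw [wt_comp_swap]; exact hσ
  unfold heisenbergBondTerm bondT vec
  by_cases h : σ i = σ (i + 1)
  · simp only [h, if_true, hσ]
    ring
  · simp only [h, if_false, hσ, hσ', if_true]
    push_cast
    ring

/-- `4 (H w)(σ) = Σ_i bondT σ i` at a weight-`7` configuration. -/
theorem four_mul_mulVec (σ : Fin 14 → Fin 2) (hσ : wt σ = 7) :
    (4 : ℂ) * (heisenbergHamiltonian 1 (ringGraph 14) 1 *ᵥ vec) σ = ((∑ i : Fin 14, bondT σ i : ℤ) : ℂ) := by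
  rw [heisenbergHamiltonian_one_mulVec_apply, sum_edgeFinset_ringGraph (by norm_num)]
  simp only [Sym2.lift_mk, Complex.ofReal_one, one_mul]
  have hnx : ∀ i : Fin 14, (⟨(i.val + 1) % 14, Nat.mod_lt _ (by norm_num)⟩ : Fin 14) = i + 1 := fun i =>
    Fin.ext (by rw [Fin.val_add]; rfl)
  simp only [hnx]
  rw [Finset.mul_sum, Finset.sum_congr rfl fun i _ => four_mul_bondTerm σ hσ i]
  push_cast
  rfl

/-- `w` lies in the `S^z = 0` sector (weight `7 = |Λ|/2`). -/
theorem vec_mem : vec ∈ spinZSector (Λ := Fin 14) 1 (((Fintype.card (Fin 14) * 1 : ℕ) : ℝ) / 2 - (7 : ℕ)) := by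
  rw [LiebMattis.mem_spinZSector_weight_iff]
  intro σ hσ
  rw [← wt_eq_sum] at hσ
  exact if_neg hσ

/-- **Strict Marshall sign rule for `w`**: `(-1)^{Σ_even σ} w(σ) = u_{cls σ} > 0` on every weight-`7` configuration. -/
theorem marshall_pos (σ : Fin 14 → Fin 2) (hσ : (∑ z, (σ z : ℕ)) = 7) :
    0 < (marshallSign (evenSites 14) σ * vec σ).re ∧ (marshallSign (evenSites 14) σ * vec σ).im = 0 := by
  rw [← wt_eq_sum] at hσ
  have hms : ((msZ σ : ℂ)) * (msZ σ : ℂ) = 1 := by exact_mod_cast msZ_mul_msZ σ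
  have hval : marshallSign (evenSites 14) σ * vec σ = ((uval (cls (enc σ)) : ℝ) : ℂ) := by
    rw [marshallSign_evenSites_eq, vec, if_pos hσ, wInt]
    push_cast
    rw [← mul_assoc, hms, one_mul]
  rw [hval, Complex.ofReal_re, Complex.ofReal_im]
  exact ⟨by exact_mod_cast uval_pos _, rfl⟩

/-- **The local energies lie in the bracket**: on every weight-`7` configuration `(Hw)(σ) = q_σ w(σ)` with
`q_σ = T'(σ)/(4 u_{cls σ}) ∈ [A/(4·10¹⁹), B/(4·10¹⁹)]`. -/
theorem local_energy (σ : Fin 14 → Fin 2) (hσ : (∑ z, (σ z : ℕ)) = 7) :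
    ∃ q : ℝ, (boundA : ℝ) / (4 * 10 ^ 19) ≤ q ∧ q ≤ (boundB : ℝ) / (4 * 10 ^ 19) ∧
      (heisenbergHamiltonian 1 (ringGraph 14) 1 *ᵥ vec) σ = (q : ℂ) * vec σ := by
  rw [← wt_eq_sum] at hσ
  obtain ⟨h1, h2⟩ := check_of_wt σ hσ
  have h4 := four_mul_mulVec σ hσ
  have hv : vec σ = ((msZ σ * uval (cls (enc σ)) : ℤ) : ℂ) := by rw [vec, if_pos hσ, wInt]
  have hms := msZ_mul_msZ σ
  have hupos := uval_pos (cls (enc σ))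
  have ht : tnum σ = msZ σ * ∑ i : Fin 14, bondT σ i := rfl
  rw [ht] at h1 h2
  generalize cls (enc σ) = k at h1 h2 hv hupos
  generalize uval k = u at h1 h2 hv hupos
  generalize (∑ i : Fin 14, bondT σ i) = S at h1 h2 h4
  generalize msZ σ = s at h1 h2 hv hms
  generalize boundA = A at h1 ⊢
  generalize boundB = B at h2 ⊢
  have hu : (0 : ℝ) < u := by exact_mod_cast hupos
  have h1' : ((A * u : ℤ) : ℝ) ≤ ((10 ^ 19 * (s * S) : ℤ) : ℝ) := by exact_mod_cast h1
  have h2' : ((10 ^ 19 * (s * S) : ℤ) : ℝ) ≤ ((B * u : ℤ) : ℝ) := by exact_mod_cast h2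
  push_cast at h1' h2'
  refine ⟨((s * S : ℤ) : ℝ) / (4 * u), ?_, ?_, ?_⟩
  · rw [div_le_div_iff₀ (by norm_num) (by linarith)]
    push_cast
    nlinarith
  · rw [div_le_div_iff₀ (by linarith) (by norm_num)]
    push_cast
    nlinarith
  · have hH : (heisenbergHamiltonian 1 (ringGraph 14) 1 *ᵥ vec) σ = (S : ℂ) / 4 := by
      rw [← h4]; ring
    have huC : (u : ℂ) ≠ 0 := by exact_mod_cast hupos.ne'
    have hmsC : (s : ℂ) * (s : ℂ) = 1 := by exact_mod_cast hms
    rw [hH, hv]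
    push_cast
    have h4C : (4 : ℂ) ≠ 0 := by norm_num
    rw [div_mul_eq_mul_div, div_eq_div_iff h4C (mul_ne_zero h4C huC)]
    linear_combination (-(4 : ℂ)) * (S : ℂ) * (u : ℂ) * hmsC

/-- The 14-ring is bipartite in its even sites. -/
theorem ringGraph_fourteen_isBipartiteWith :
    (ringGraph 14).IsBipartiteWith ((evenSites 14 : Finset (Fin 14)) : Set (Fin 14)) (↑(evenSites 14))ᶜ where
  disjoint := disjoint_compl_right
  mem_of_adj := fun x y hxy => by
    have h := evenSites_bipartite 7 x y hxy
    simp only [Set.mem_compl_iff, Finset.mem_coe]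
    by_cases hx : x ∈ evenSites 14
    · exact Or.inl ⟨hx, (h.1 hx)⟩
    · exact Or.inr ⟨hx, by_contra fun hy => hx (h.2 hy)⟩

/-- **T-H14(α-bracket).** `E₀(Σ_{i∈ℤ/14} 𝐒_i·𝐒_{i+1}) ∈ [A/(4·10¹⁹), B/(4·10¹⁹)]` (width `1.2e-16`). -/
theorem groundEnergy_mem_Icc' :
    (boundA : ℝ) / (4 * 10 ^ 19) ≤ (heisenbergHamiltonian 1 (ringGraph 14) 1).groundEnergy ∧
      (heisenbergHamiltonian 1 (ringGraph 14) 1).groundEnergy ≤ (boundB : ℝ) / (4 * 10 ^ 19) :=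
  groundEnergy_mem_Icc_of_marshall_positive_trial 1 (ringGraph 14) 1 (evenSites 14)
    (ringGraph_connected (by norm_num)) ringGraph_fourteen_isBipartiteWith one_pos 7 (by simp) ⟨cfg 10922, by decide⟩
    vec_mem marshall_pos local_energy

/-- **T-H14(α-bracket), decimals.** `E₀(Σ_{i∈ℤ/14} 𝐒_i·𝐒_{i+1}) ∈ [-6.263549533547038, -6.263549533547036]`. -/
theorem groundEnergy_mem_Icc : (heisenbergHamiltonian 1 (ringGraph 14) 1).groundEnergy ∈
    Set.Icc (-(6263549533547038 / 10 ^ 15 : ℝ)) (-(6263549533547036 / 10 ^ 15)) := by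
  obtain ⟨hlo, hhi⟩ := groundEnergy_mem_Icc'
  rw [boundA] at hlo
  rw [boundB] at hhi
  push_cast at hlo hhi
  constructor <;> linarith

/-- **`h(14) ∈ [9.763549533547036, 9.763549533547038]`**, `h(14) := 7/2 − E₀(Σ_{i∈ℤ/14} 𝐒_i·𝐒_{i+1})` (the h-input STRUCTURE
§2.5.7 (F1) names; of record at grade (β) from `h-cw-cert/cw_L14.json`, whose bracket contains this one). -/
theorem h14_mem_Icc : 7 / 2 - (heisenbergHamiltonian 1 (ringGraph 14) 1).groundEnergy ∈
    Set.Icc (9763549533547036 / 10 ^ 15 : ℝ) (9763549533547038 / 10 ^ 15) := by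
  obtain ⟨hlo, hhi⟩ := groundEnergy_mem_Icc
  constructor <;> linarith

end HeisenbergRing14

end Summit.Ventures.CertifiedQuantumChemistry

end
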